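import Mathlib
import HarnessLib

/-!
# Trial integrals for the dominant-quadruple odd trial function

Route `WeilParity`, crux `OffLineParityDetection` (item stmt-RiemannHypothesis-15431), line
`registered`, stub `stub_dominantQuadrupleOddTrial` (TRIAL).  This is a pure real-analysis helper
file (no zeta facts, no definitions): closed forms and elementary estimates for the integrals of
products of hyperbolic and trigonometric functions over symmetric windows `[-a, a]` that govern the
odd trial function `o(t) = χ(t) sinh(η t) cos(γ t)` of the stub.

* `trial_integral_odd_eq_zero` — the integral over `ℝ` of an odd real function vanishes;
* `trial_integral_cosh_mul_cos`, `trial_integral_sinh_mul_sin` — the closed forms of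
  `∫_{-a}^{a} cosh(ut) cos(vt) dt` and `∫_{-a}^{a} sinh(ut) sin(vt) dt` (`u² + v² ≠ 0`), by the
  fundamental theorem of calculus with the explicit (odd) antiderivatives;
* `trial_sinh_sq_mul_cos_sq_sub` — the pointwise identity
  `sinh²(ηt) cos²(γt) - sinh²(ηt) sin²(γt) = (cosh(2ηt) cos(2γt) - cos(2γt)) / 2`, and
  `trial_gap_integral_ge` — the resulting bound
  `∫_{-a}^{a} (sinh² cos² - sinh² sin²) ≥ D(a)/2 - a` with `D(a) = ∫_{-a}^{a} cosh(2ηt) cos(2γt) dt`;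
* `trial_phase_gap_ge`, `trial_phase_abs_cross_le` — at a phase `cos(2γa) = η/r`,
  `sin(2γa) = γ/r` (`r² = η² + γ²`, `η > 0`): `D(a) ≥ sinh(2ηa)/r` and
  `|∫_{-a}^{a} sinh(2ηt) sin(2γt) dt| ≤ 1/r`;
* `trial_exists_phase`, `trial_exists_growth_phase` — such phases exist beyond any bound, and
  beyond the point where `C a² < e^{εa}`;
* elementary `sinh` / `cosh` / `exp` inequalities used by the trial-function estimates.

Everything is folklore calculus and fully proved.
-/

set_option linter.dupNamespace false

noncomputable section

namespace Summit.RiemannHypothesis.RiemannHypothesis.Theorems.WeilParityOffLineParityDetection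

open MeasureTheory Set Real intervalIntegral

/-! ## Odd integrands -/

/-- The integral over `ℝ` of an odd real function vanishes (Lebesgue measure is invariant under
`t ↦ -t`; no integrability is needed, both sides being junk together). [folklore] -/
theorem trial_integral_odd_eq_zero {F : ℝ → ℝ} (hF : ∀ t, F (-t) = -F t) : ∫ t, F t = 0 := by
  have h : ∫ t, F (-t) = ∫ t, F t := integral_neg_eq_self F volume
  simp_rw [hF, MeasureTheory.integral_neg] at h
  linarith

/-! ## Closed forms on symmetric windows -/

/-- `x ↦ c x` has derivative `c`. [folklore] -/
theorem trial_hasDerivAt_const_mul (c t : ℝ) : HasDerivAt (fun x : ℝ ↦ c * x) c t := by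
  simpa using (hasDerivAt_id t).const_mul c

/-- **Closed form** `∫_{-a}^{a} cosh(ut) cos(vt) dt = 2 (u sinh(ua) cos(va) + v cosh(ua) sin(va)) / (u² + v²)`
for `u² + v² ≠ 0`: the antiderivative is `(u sinh(ut) cos(vt) + v cosh(ut) sin(vt)) / (u² + v²)`,
an odd function of `t`. [folklore] -/
theorem trial_integral_cosh_mul_cos (u v a : ℝ) (h : u ^ 2 + v ^ 2 ≠ 0) :
    ∫ t in (-a)..a, Real.cosh (u * t) * Real.cos (v * t) =
      2 * (u * Real.sinh (u * a) * Real.cos (v * a) + v * Real.cosh (u * a) * Real.sin (v * a)) /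
        (u ^ 2 + v ^ 2) := by
  have hderiv : ∀ t, HasDerivAt (fun x : ℝ ↦ (u * Real.sinh (u * x) * Real.cos (v * x) +
      v * Real.cosh (u * x) * Real.sin (v * x)) / (u ^ 2 + v ^ 2))
      (Real.cosh (u * t) * Real.cos (v * t)) t := by
    intro t
    have h1 := ((trial_hasDerivAt_const_mul u t).sinh.const_mul u).fun_mul
      (trial_hasDerivAt_const_mul v t).cos
    have h2 := ((trial_hasDerivAt_const_mul u t).cosh.const_mul v).fun_mul
      (trial_hasDerivAt_const_mul v t).sin
    refine ((h1.fun_add h2).div_const (u ^ 2 + v ^ 2)).congr_deriv ?_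
    field_simp
    ring
  rw [integral_eq_sub_of_hasDerivAt (fun t _ ↦ hderiv t) ((by fun_prop :
    Continuous fun t : ℝ ↦ Real.cosh (u * t) * Real.cos (v * t)).intervalIntegrable _ _)]
  simp only [mul_neg, Real.sinh_neg, Real.cos_neg, Real.cosh_neg, Real.sin_neg]
  field_simp
  ring

/-- **Closed form** `∫_{-a}^{a} sinh(ut) sin(vt) dt = 2 (u cosh(ua) sin(va) - v sinh(ua) cos(va)) / (u² + v²)`
for `u² + v² ≠ 0`: the antiderivative is `(u cosh(ut) sin(vt) - v sinh(ut) cos(vt)) / (u² + v²)`,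
an odd function of `t`. [folklore] -/
theorem trial_integral_sinh_mul_sin (u v a : ℝ) (h : u ^ 2 + v ^ 2 ≠ 0) :
    ∫ t in (-a)..a, Real.sinh (u * t) * Real.sin (v * t) =
      2 * (u * Real.cosh (u * a) * Real.sin (v * a) - v * Real.sinh (u * a) * Real.cos (v * a)) /
        (u ^ 2 + v ^ 2) := by
  have hderiv : ∀ t, HasDerivAt (fun x : ℝ ↦ (u * Real.cosh (u * x) * Real.sin (v * x) -
      v * Real.sinh (u * x) * Real.cos (v * x)) / (u ^ 2 + v ^ 2))
      (Real.sinh (u * t) * Real.sin (v * t)) t := by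
    intro t
    have h1 := ((trial_hasDerivAt_const_mul u t).cosh.const_mul u).fun_mul
      (trial_hasDerivAt_const_mul v t).sin
    have h2 := ((trial_hasDerivAt_const_mul u t).sinh.const_mul v).fun_mul
      (trial_hasDerivAt_const_mul v t).cos
    refine ((h1.fun_sub h2).div_const (u ^ 2 + v ^ 2)).congr_deriv ?_
    field_simp
    ring
  rw [integral_eq_sub_of_hasDerivAt (fun t _ ↦ hderiv t) ((by fun_prop :
    Continuous fun t : ℝ ↦ Real.sinh (u * t) * Real.sin (v * t)).intervalIntegrable _ _)]
  simp only [mul_neg, Real.sinh_neg, Real.cos_neg, Real.cosh_neg, Real.sin_neg]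
  field_simp
  ring

/-! ## The gap integrand `sinh² cos² - sinh² sin²` -/

/-- Pointwise: `sinh²(ηt) cos²(γt) - sinh²(ηt) sin²(γt) = (cosh(2ηt) cos(2γt) - cos(2γt)) / 2`. [folklore] -/
theorem trial_sinh_sq_mul_cos_sq_sub (η γ t : ℝ) :
    Real.sinh (η * t) ^ 2 * Real.cos (γ * t) ^ 2 - Real.sinh (η * t) ^ 2 * Real.sin (γ * t) ^ 2 =
      (Real.cosh (2 * η * t) * Real.cos (2 * γ * t) - Real.cos (2 * γ * t)) / 2 := by
  have h1 := Real.cosh_two_mul (η * t)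
  have h2 := Real.cosh_sq' (η * t)
  have h3 := Real.cos_two_mul (γ * t)
  have h4 := Real.sin_sq (γ * t)
  rw [show 2 * η * t = 2 * (η * t) by ring, show 2 * γ * t = 2 * (γ * t) by ring, h1, h3, h4]
  nlinarith [h2]

/-- Pointwise: `sinh(ηt) cos(γt) · cosh(ηt) sin(γt) = sinh(2ηt) sin(2γt) / 4`. [folklore] -/
theorem trial_sinh_cos_cosh_sin (η γ t : ℝ) :
    Real.sinh (η * t) * Real.cos (γ * t) * (Real.cosh (η * t) * Real.sin (γ * t)) =
      Real.sinh (2 * η * t) * Real.sin (2 * γ * t) / 4 := by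
  rw [show 2 * η * t = 2 * (η * t) by ring, show 2 * γ * t = 2 * (γ * t) by ring,
    Real.sinh_two_mul, Real.sin_two_mul]
  ring

/-- **The gap integral.** For `0 ≤ a`:
`∫_{-a}^{a} (sinh²(ηt) cos²(γt) - sinh²(ηt) sin²(γt)) dt ≥ D(a)/2 - a`, where
`D(a) = ∫_{-a}^{a} cosh(2ηt) cos(2γt) dt` (the remaining term `-∫ cos(2γt)/2` is at least `-a`). [folklore] -/
theorem trial_gap_integral_ge (η γ a : ℝ) (ha : 0 ≤ a) :
    (∫ t in (-a)..a, Real.cosh (2 * η * t) * Real.cos (2 * γ * t)) / 2 - a ≤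
      ∫ t in (-a)..a, (Real.sinh (η * t) ^ 2 * Real.cos (γ * t) ^ 2 -
        Real.sinh (η * t) ^ 2 * Real.sin (γ * t) ^ 2) := by
  simp_rw [trial_sinh_sq_mul_cos_sq_sub]
  have hc1 : Continuous fun t : ℝ ↦ Real.cosh (2 * η * t) * Real.cos (2 * γ * t) := by fun_prop
  have hc2 : Continuous fun t : ℝ ↦ Real.cos (2 * γ * t) := by fun_prop
  rw [intervalIntegral.integral_div, intervalIntegral.integral_sub (hc1.intervalIntegrable _ _)
    (hc2.intervalIntegrable _ _)]
  have hb : ‖∫ t in (-a)..a, Real.cos (2 * γ * t)‖ ≤ 1 * |a - -a| :=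
    intervalIntegral.norm_integral_le_of_norm_le_const fun t _ ↦ by
      rw [Real.norm_eq_abs]
      exact Real.abs_cos_le_one (2 * γ * t)
  rw [Real.norm_eq_abs, show a - -a = 2 * a by ring,
    abs_of_nonneg (show (0 : ℝ) ≤ 2 * a by linarith), one_mul] at hb
  have := le_abs_self (∫ t in (-a)..a, Real.cos (2 * γ * t))
  linarith

/-! ## Evaluation at the phase `cos(2γa) = η/r`, `sin(2γa) = γ/r` -/

/-- At the phase `cos(2γa) = η/r`, `sin(2γa) = γ/r` with `r = √(η² + γ²)` and `η > 0`:
`D(a) = ∫_{-a}^{a} cosh(2ηt) cos(2γt) dt ≥ sinh(2ηa) / r`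
(`D(a) = (η² sinh(2ηa) + γ² cosh(2ηa)) / r³` and `cosh ≥ sinh`). [folklore] -/
theorem trial_phase_gap_ge {η γ a : ℝ} (hη : 0 < η)
    (hcos : Real.cos (2 * γ * a) = η / Real.sqrt (η ^ 2 + γ ^ 2))
    (hsin : Real.sin (2 * γ * a) = γ / Real.sqrt (η ^ 2 + γ ^ 2)) :
    Real.sinh (2 * η * a) / Real.sqrt (η ^ 2 + γ ^ 2) ≤
      ∫ t in (-a)..a, Real.cosh (2 * η * t) * Real.cos (2 * γ * t) := by
  set r := Real.sqrt (η ^ 2 + γ ^ 2) with hr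
  have hr2 : r ^ 2 = η ^ 2 + γ ^ 2 := Real.sq_sqrt (by positivity)
  have hrpos : 0 < r := Real.sqrt_pos.2 (by positivity)
  have hne : (2 * η) ^ 2 + (2 * γ) ^ 2 ≠ 0 := by positivity
  rw [trial_integral_cosh_mul_cos _ _ _ hne, hcos, hsin]
  have hsc : Real.sinh (2 * η * a) ≤ Real.cosh (2 * η * a) := (Real.sinh_lt_cosh _).le
  rw [div_le_div_iff₀ hrpos (by positivity)]
  have key : Real.sinh (2 * η * a) * ((2 * η) ^ 2 + (2 * γ) ^ 2) ≤
      2 * (2 * η * Real.sinh (2 * η * a) * η + 2 * γ * Real.cosh (2 * η * a) * γ) := by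
    nlinarith [sq_nonneg γ, hsc]
  calc Real.sinh (2 * η * a) * ((2 * η) ^ 2 + (2 * γ) ^ 2)
      ≤ 2 * (2 * η * Real.sinh (2 * η * a) * η + 2 * γ * Real.cosh (2 * η * a) * γ) := key
    _ = 2 * (2 * η * Real.sinh (2 * η * a) * (η / r) + 2 * γ * Real.cosh (2 * η * a) * (γ / r)) * r := by
        field_simp

/-- At the same phase: `∫_{-a}^{a} sinh(2ηt) sin(2γt) dt = ηγ e^{-2ηa} / r³`, hence
`|∫_{-a}^{a} sinh(2ηt) sin(2γt) dt| ≤ 1 / r` (for `a ≥ 0`). [folklore] -/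
theorem trial_phase_abs_cross_le {η γ a : ℝ} (hη : 0 < η) (ha : 0 ≤ a)
    (hcos : Real.cos (2 * γ * a) = η / Real.sqrt (η ^ 2 + γ ^ 2))
    (hsin : Real.sin (2 * γ * a) = γ / Real.sqrt (η ^ 2 + γ ^ 2)) :
    |∫ t in (-a)..a, Real.sinh (2 * η * t) * Real.sin (2 * γ * t)| ≤
      1 / Real.sqrt (η ^ 2 + γ ^ 2) := by
  set r := Real.sqrt (η ^ 2 + γ ^ 2) with hr
  have hr2 : r ^ 2 = η ^ 2 + γ ^ 2 := Real.sq_sqrt (by positivity)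
  have hrpos : 0 < r := Real.sqrt_pos.2 (by positivity)
  have hne : (2 * η) ^ 2 + (2 * γ) ^ 2 ≠ 0 := by positivity
  have hηr : |η| ≤ r := Real.abs_le_sqrt (by nlinarith [sq_nonneg γ])
  have hγr : |γ| ≤ r := Real.abs_le_sqrt (by nlinarith [sq_nonneg η])
  have hE : Real.cosh (2 * η * a) - Real.sinh (2 * η * a) = Real.exp (-(2 * η * a)) :=
    Real.cosh_sub_sinh _
  have hE1 : Real.exp (-(2 * η * a)) ≤ 1 := Real.exp_le_one_iff.2 (by nlinarith)
  have hE0 : 0 < Real.exp (-(2 * η * a)) := Real.exp_pos _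
  rw [trial_integral_sinh_mul_sin _ _ _ hne, hcos, hsin]
  have heq : 2 * (2 * η * Real.cosh (2 * η * a) * (γ / r) - 2 * γ * Real.sinh (2 * η * a) * (η / r)) /
      ((2 * η) ^ 2 + (2 * γ) ^ 2) = η * γ * Real.exp (-(2 * η * a)) / (r * r ^ 2) := by
    rw [← hE, hr2]
    field_simp
  rw [heq, abs_div, abs_mul, abs_mul, abs_of_pos hE0, abs_of_pos (by positivity : 0 < r * r ^ 2),
    div_le_div_iff₀ (by positivity) hrpos]
  have h1 : |η| * |γ| ≤ r * r := mul_le_mul hηr hγr (abs_nonneg _) hrpos.le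
  have h2 : |η| * |γ| * Real.exp (-(2 * η * a)) ≤ r * r * 1 :=
    mul_le_mul h1 hE1 hE0.le (by positivity)
  nlinarith [h2, hrpos]

/-! ## Phases and exponential domination -/

/-- **Phases exist beyond any bound.** For `η > 0` and any `γ, A` there is `a ≥ A` with
`cos(2γa) = η/r` and `sin(2γa) = γ/r`, `r = √(η² + γ²)`: for `γ = 0` every `a` works; for
`γ ≠ 0` take `a = (θ + 2πk)/(2γ)` with `θ = arg(η + iγ)` and `k ∈ ℤ` of the right sign. [folklore] -/
theorem trial_exists_phase {η : ℝ} (hη : 0 < η) (γ A : ℝ) :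
    ∃ a : ℝ, A ≤ a ∧ Real.cos (2 * γ * a) = η / Real.sqrt (η ^ 2 + γ ^ 2) ∧
      Real.sin (2 * γ * a) = γ / Real.sqrt (η ^ 2 + γ ^ 2) := by
  by_cases hγ : γ = 0
  · subst hγ
    refine ⟨A, le_rfl, ?_, ?_⟩
    · rw [show (2 : ℝ) * 0 * A = 0 by ring, Real.cos_zero, show η ^ 2 + (0 : ℝ) ^ 2 = η ^ 2 by ring,
        Real.sqrt_sq hη.le, div_self hη.ne']
    · rw [show (2 : ℝ) * 0 * A = 0 by ring, Real.sin_zero, zero_div]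
  · set z : ℂ := ⟨η, γ⟩ with hz
    have hz0 : z ≠ 0 := fun h ↦ hγ (by simpa [hz] using congrArg Complex.im h)
    have hnorm : ‖z‖ = Real.sqrt (η ^ 2 + γ ^ 2) := by
      rw [Complex.norm_def, Complex.normSq_mk]
      congr 1
      ring
    have hc : Real.cos (Complex.arg z) = η / Real.sqrt (η ^ 2 + γ ^ 2) := by
      rw [Complex.cos_arg hz0, hnorm]
    have hs : Real.sin (Complex.arg z) = γ / Real.sqrt (η ^ 2 + γ ^ 2) := by
      rw [Complex.sin_arg, hnorm]
    set θ : ℝ := Complex.arg z with hθ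
    have h2γ : (2 : ℝ) * γ ≠ 0 := mul_ne_zero two_ne_zero hγ
    obtain ⟨k, hk⟩ : ∃ k : ℤ, A ≤ (θ + k * (2 * π)) / (2 * γ) := by
      rcases lt_or_gt_of_ne hγ with hneg | hpos
      · obtain ⟨k, hk⟩ := exists_int_lt ((2 * γ * A - θ) / (2 * π))
        refine ⟨k, ?_⟩
        rw [le_div_iff_of_neg (by linarith)]
        have := (lt_div_iff₀ (by positivity : (0 : ℝ) < 2 * π)).1 hk
        linarith
      · obtain ⟨k, hk⟩ := exists_int_gt ((2 * γ * A - θ) / (2 * π))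
        refine ⟨k, ?_⟩
        rw [le_div_iff₀ (by positivity)]
        have := (div_lt_iff₀ (by positivity : (0 : ℝ) < 2 * π)).1 hk
        linarith
    have harg : 2 * γ * ((θ + k * (2 * π)) / (2 * γ)) = θ + k * (2 * π) := by
      field_simp
    refine ⟨(θ + k * (2 * π)) / (2 * γ), hk, ?_, ?_⟩
    · rw [harg, Real.cos_add_int_mul_two_pi, hc]
    · rw [harg, Real.sin_add_int_mul_two_pi, hs]

/-- **Exponential domination**: for `ε > 0` and any `C`, `C a² < e^{εa}` for all large `a`
(`e^{εa} = (e^{εa/3})³ ≥ (1 + εa/3)³ > (εa/3)³`). [folklore] -/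
theorem trial_exists_growth {ε : ℝ} (hε : 0 < ε) (C : ℝ) :
    ∃ A : ℝ, ∀ a, A ≤ a → C * a ^ 2 < Real.exp (ε * a) := by
  refine ⟨max 1 (27 * C / ε ^ 3 + 1), fun a ha ↦ ?_⟩
  have ha1 : 1 ≤ a := (le_max_left _ _).trans ha
  have ha2 : 27 * C / ε ^ 3 < a := by
    have := (le_max_right _ _).trans ha
    linarith
  have hCa : 27 * C < a * ε ^ 3 := (div_lt_iff₀ (by positivity)).1 ha2
  have hx : 0 ≤ ε * a / 3 := by positivity
  have hexp : Real.exp (ε * a) = Real.exp (ε * a / 3) ^ 3 := by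
    rw [← Real.exp_nat_mul]
    congr 1
    push_cast
    ring
  have h1 : ε * a / 3 + 1 ≤ Real.exp (ε * a / 3) := Real.add_one_le_exp _
  have key : C * a ^ 2 < (ε * a / 3) ^ 3 := by
    have hpos : 0 < a ^ 2 * (a * ε ^ 3 - 27 * C) := mul_pos (by positivity) (sub_pos.2 hCa)
    nlinarith [hpos]
  calc C * a ^ 2 < (ε * a / 3) ^ 3 := key
    _ ≤ (ε * a / 3 + 1) ^ 3 := pow_le_pow_left₀ hx (by linarith) 3
    _ ≤ Real.exp (ε * a / 3) ^ 3 := pow_le_pow_left₀ (by positivity) h1 3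
    _ = Real.exp (ε * a) := hexp.symm

/-- Phases `cos(2γa) = η/r`, `sin(2γa) = γ/r` with `a ≥ 1` beyond the exponential-domination
point `C a² < e^{εa}`. [folklore] -/
theorem trial_exists_growth_phase :
    ∀ (η ε γ C : ℝ), 0 < η → 0 < ε → ∃ a : ℝ, 1 ≤ a ∧ C * a ^ 2 < Real.exp (ε * a) ∧
      Real.cos (2 * γ * a) = η / Real.sqrt (η ^ 2 + γ ^ 2) ∧
      Real.sin (2 * γ * a) = γ / Real.sqrt (η ^ 2 + γ ^ 2) := by
  intro η ε γ C hη hε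
  obtain ⟨A, hA⟩ := trial_exists_growth hε C
  obtain ⟨a, ha, hc, hs⟩ := trial_exists_phase hη γ (max A 1)
  exact ⟨a, (le_max_right _ _).trans ha, hA a ((le_max_left _ _).trans ha), hc, hs⟩

/-! ## Elementary hyperbolic inequalities -/

/-- `e^x / 4 ≤ sinh x` once `e^x ≥ 2`. [folklore] -/
theorem trial_exp_div_four_le_sinh {x : ℝ} (hx : 2 ≤ Real.exp x) :
    Real.exp x / 4 ≤ Real.sinh x := by
  rw [Real.sinh_eq]
  have h1 : Real.exp (-x) * Real.exp x = 1 := by rw [← Real.exp_add]; simp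
  have h2 : 0 < Real.exp (-x) := Real.exp_pos _
  nlinarith

/-- `sinh² x ≤ e^{2x}` for `x ≥ 0` (`0 ≤ sinh x = (e^x - e^{-x})/2 ≤ e^x`; the tree's
`cosh_le_exp_of_nonneg` / `abs_sinh_le_cosh` live in unrelated Literature files and are not
re-stated here). [folklore] -/
theorem trial_sinh_sq_le_exp {x : ℝ} (hx : 0 ≤ x) : Real.sinh x ^ 2 ≤ Real.exp (2 * x) := by
  have h0 : 0 ≤ Real.sinh x := Real.sinh_nonneg_iff.2 hx
  have h1 : Real.sinh x ≤ Real.exp x := by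
    rw [Real.sinh_eq]
    linarith [Real.exp_pos (-x), Real.exp_pos x]
  calc Real.sinh x ^ 2 ≤ Real.exp x ^ 2 := pow_le_pow_left₀ h0 h1 2
    _ = Real.exp (2 * x) := by rw [← Real.exp_nat_mul]; norm_num

/-- On the window `|t| ≤ a`: `cosh(ηt) ≤ cosh(|η| a)`. [folklore] -/
theorem trial_cosh_le_cosh_window {η t a : ℝ} (ht : |t| ≤ a) :
    Real.cosh (η * t) ≤ Real.cosh (|η| * a) := by
  rw [Real.cosh_le_cosh, abs_mul]
  have ha : 0 ≤ a := (abs_nonneg t).trans ht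
  rw [abs_of_nonneg (mul_nonneg (abs_nonneg η) ha)]
  exact mul_le_mul_of_nonneg_left ht (abs_nonneg η)

/-- On the window `|t| ≤ a`: `sinh²(ηt) ≤ sinh²(|η| a)`. [folklore] -/
theorem trial_sinh_sq_le_window {η t a : ℝ} (ht : |t| ≤ a) :
    Real.sinh (η * t) ^ 2 ≤ Real.sinh (|η| * a) ^ 2 := by
  rw [Real.sinh_sq, Real.sinh_sq]
  have h := trial_cosh_le_cosh_window (η := η) ht
  nlinarith [Real.cosh_pos (η * t)]

/-- On the window `|t| ≤ a`, for `η > 0`: `|sinh(ηt)| ≤ sinh(ηa)`. [folklore] -/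
theorem trial_abs_sinh_le_window {η t a : ℝ} (hη : 0 < η) (ht : |t| ≤ a) :
    |Real.sinh (η * t)| ≤ Real.sinh (η * a) := by
  have ha : 0 ≤ a := (abs_nonneg t).trans ht
  have h := trial_sinh_sq_le_window (η := η) ht
  rw [abs_of_pos hη] at h
  have h0 : 0 ≤ Real.sinh (η * a) := Real.sinh_nonneg_iff.2 (by positivity)
  exact abs_le.2 (abs_le_of_sq_le_sq' h h0)

/-- On the window `|t| ≤ a`: `sinh²(ηt) ≤ e^{2|η|a}`. [folklore] -/
theorem trial_sinh_sq_le_exp_window {η t a : ℝ} (ht : |t| ≤ a) :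
    Real.sinh (η * t) ^ 2 ≤ Real.exp (2 * |η| * a) := by
  have ha : 0 ≤ a := (abs_nonneg t).trans ht
  calc Real.sinh (η * t) ^ 2 ≤ Real.sinh (|η| * a) ^ 2 := trial_sinh_sq_le_window ht
    _ ≤ Real.exp (2 * (|η| * a)) := trial_sinh_sq_le_exp (by positivity)
    _ = Real.exp (2 * |η| * a) := by rw [mul_assoc]

/-! ## Windows and boundary layers -/

/-- `∫_{[-a, a]} F = ∫_{-a}^{a} F` for `a ≥ 0`. [folklore] -/
theorem trial_integral_Icc_eq {F : ℝ → ℝ} {a : ℝ} (ha : 0 ≤ a) :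
    ∫ t in Icc (-a) a, F t = ∫ t in (-a)..a, F t := by
  rw [integral_Icc_eq_integral_Ioc, intervalIntegral.integral_of_le (by linarith)]

/-- **Boundary layer.** For continuous `F` with `|F| ≤ B` on `[-a, a]` and `0 ≤ b ≤ a`:
`|∫_{-a}^{a} F - ∫_{-b}^{b} F| ≤ 2 (a - b) B` (the difference is the integral over the two layers
`[-a, -b]` and `[b, a]`). [folklore] -/
theorem trial_layer_le {F : ℝ → ℝ} (hF : Continuous F) {a b B : ℝ} (hb : 0 ≤ b) (hba : b ≤ a)
    (hB : ∀ t, |t| ≤ a → |F t| ≤ B) :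
    |(∫ t in (-a)..a, F t) - ∫ t in (-b)..b, F t| ≤ 2 * (a - b) * B := by
  have h1 := integral_add_adjacent_intervals (hF.intervalIntegrable (μ := volume) (-a) (-b))
    (hF.intervalIntegrable (-b) a)
  have h2 := integral_add_adjacent_intervals (hF.intervalIntegrable (μ := volume) (-b) b)
    (hF.intervalIntegrable b a)
  have hwin : ∀ t, t ∈ Set.uIoc (-a) (-b) ∨ t ∈ Set.uIoc b a → |t| ≤ a := by
    intro t ht
    rcases ht with ht | ht <;> rcases Set.mem_uIoc.1 ht with ⟨h3, h4⟩ | ⟨h3, h4⟩ <;>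
      exact abs_le.2 ⟨by linarith, by linarith⟩
  have hL : ‖∫ t in (-a)..(-b), F t‖ ≤ B * |(-b) - (-a)| :=
    norm_integral_le_of_norm_le_const fun t ht ↦ by
      rw [Real.norm_eq_abs]
      exact hB t (hwin t (Or.inl ht))
  have hR : ‖∫ t in b..a, F t‖ ≤ B * |a - b| :=
    norm_integral_le_of_norm_le_const fun t ht ↦ by
      rw [Real.norm_eq_abs]
      exact hB t (hwin t (Or.inr ht))
  rw [Real.norm_eq_abs, show (-b) - (-a) = a - b by ring, abs_of_nonneg (by linarith : 0 ≤ a - b)]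
    at hL
  rw [Real.norm_eq_abs, abs_of_nonneg (by linarith : 0 ≤ a - b)] at hR
  have heq : (∫ t in (-a)..a, F t) - ∫ t in (-b)..b, F t =
      (∫ t in (-a)..(-b), F t) + ∫ t in b..a, F t := by linarith
  rw [heq]
  calc |(∫ t in (-a)..(-b), F t) + ∫ t in b..a, F t|
      ≤ |∫ t in (-a)..(-b), F t| + |∫ t in b..a, F t| := abs_add_le _ _
    _ ≤ B * (a - b) + B * (a - b) := add_le_add hL hR
    _ = 2 * (a - b) * B := by ring

end Summit.RiemannHypothesis.RiemannHypothesis.Theorems.WeilParityOffLineParityDetection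

end
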